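import Summits.KontsevichZagierPeriods.KontsevichZagierPeriods.Theorems.OctahedralSymmetryOctahedralSpanAllWeightsDefs
import Mathlib.LinearAlgebra.Span.Basic
import Mathlib.Tactic.LinearCombination

/-!
# Crux `OctahedralSpanAllWeights` (stmt-KontsevichZagierPeriods-9659), line `Sketch`, block F2: involution of the one-letter layer and the algebraic core

Block F2 of the two-letter normal form concerns UNIT words (letters `1, 2, 3` = poles `i, −1, −i`). For the
layer of unit words with exactly one letter other than `2` (the words `X = 2^a c 2^b` and the auxiliary
`V = 2^m c c'`) this file computes the involution relators explicitly — `toQ_sigmaSubst_X`: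
`σ(2^a c 2^b) = −[2^b c̄ 2^a] + [2^{a+b+1}]`, `toQ_sigmaSubst_V` (four terms): in the `σ`-eigenbasis of the unit
letters the involution is a signed reversal — and proves the abstract `ℚ`-module elimination
`layerOne_core` that the layer theorem `unitLayerOne` (file `…StubRegularUnitLayerOne`) instantiates.
Sources: J. Zhao, C. R. Acad. Sci. Paris 346 (2008) §4 (the involution `σ`) [Zhao2008]; J. Zhao, Doc. Math.
15 (2010) §2 [Zhao2010].
-/

noncomputable section

namespace Summit.KontsevichZagierPeriods.OctahedralSymmetry.OctaSpan.RegularUnit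

open Literature.NumberTheory.Transcendental Literature.NumberTheory.Transcendental.LevelFour

/-! ### The involution on the words `2^a c 2^b` and `2^m c c'` -/

/-- `(-1)^k · (-1)^k = 1` in `ℤ`. [folklore] -/
theorem neg_one_pow_mul_self (k : ℕ) : (-1 : ℤ) ^ k * (-1) ^ k = 1 := by
  rw [← mul_pow, neg_mul_neg, one_mul, one_pow]

/-- `expand sigmaLetter` of a block of letters `2`: the single term `((-1)^a, 2^a)`. [folklore] -/
theorem expand_sigma_replicate_two (a : ℕ) :
    expand sigmaLetter (List.replicate a (2 : Fin 5)) = [((-1 : ℤ) ^ a, List.replicate a 2)] := by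
  induction a with
  | zero => rfl
  | succ a ih =>
    rw [List.replicate_succ, expand_cons, ih]
    simp [sigmaLetter, pow_succ, mul_comm]

/-- `expand sigmaLetter` through a leading block of letters `2`. [folklore] -/
theorem expand_sigma_replicate_append (a : ℕ) (r : List (Fin 5)) :
    expand sigmaLetter (List.replicate a (2 : Fin 5) ++ r) =
      (expand sigmaLetter r).map fun q => ((-1 : ℤ) ^ a * q.1, List.replicate a 2 ++ q.2) := by
  induction a with
  | zero => simp
  | succ a ih =>
    rw [List.replicate_succ, List.cons_append, expand_cons, ih]
    simp [sigmaLetter, List.map_map, Function.comp_def, pow_succ]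

/-- The letter table of the involution on the poles `±i`: `σ^*ω_{±i} = ω_{∓i} − ω_{−1}`. [cite: Zhao2008, §4] -/
theorem sigmaLetter_of_unit {c cb : Fin 5} (h : (c = 1 ∧ cb = 3) ∨ (c = 3 ∧ cb = 1)) :
    sigmaLetter c = [(1, cb), (-1, 2)] := by
  rcases h with ⟨rfl, rfl⟩ | ⟨rfl, rfl⟩ <;> rfl

/-- **The involution of `X = 2^a c 2^b`** (`c = ±i`, `c̄ = ∓i`):
`toQ (sigmaSubst X) = −[2^b c̄ 2^a] + [2^{a+b+1}]`. [cite: Zhao2008, §4] -/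
theorem toQ_sigmaSubst_X {c cb : Fin 5} (h : (c = 1 ∧ cb = 3) ∨ (c = 3 ∧ cb = 1)) (a b : ℕ) :
    toQ (sigmaSubst (List.replicate a (2 : Fin 5) ++ c :: List.replicate b 2)) =
      -sym (List.replicate b (2 : Fin 5) ++ cb :: List.replicate a 2) +
        sym (List.replicate (a + b + 1) (2 : Fin 5)) := by
  have htail : expand sigmaLetter (c :: List.replicate b (2 : Fin 5)) =
      [((-1 : ℤ) ^ b, cb :: List.replicate b 2), (-(-1 : ℤ) ^ b, 2 :: List.replicate b 2)] := by
    rw [expand_cons, sigmaLetter_of_unit h, expand_sigma_replicate_two]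
    simp
  have hlen : (List.replicate a (2 : Fin 5) ++ c :: List.replicate b 2).length = a + b + 1 := by
    simp; omega
  rw [sigmaSubst, hlen, expand_sigma_replicate_append, htail]
  simp only [List.map_cons, List.map_nil, List.reverse_append, List.reverse_cons, List.reverse_replicate,
    ofTerms_cons, ofTerms_nil, add_zero, map_zsmul, map_add, toQ_single]
  have h1 : List.replicate b (2 : Fin 5) ++ [cb] ++ List.replicate a 2 =
      List.replicate b 2 ++ cb :: List.replicate a 2 := by simp
  have h2 : List.replicate b (2 : Fin 5) ++ [2] ++ List.replicate a 2 = List.replicate (a + b + 1) 2 := by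
    rw [← List.replicate_succ', List.replicate_append_replicate]; congr 1; omega
  rw [h1, h2, smul_add, smul_smul, smul_smul, pow_succ, mul_neg ((-1 : ℤ) ^ a), ← pow_add]
  set u : ℤ := (-1) ^ (a + b) with hu_def
  have hu : u * u = 1 := neg_one_pow_mul_self _
  have c1 : u * -1 * u = -1 := by linear_combination (-1 : ℤ) * hu
  have c2 : u * -1 * -u = 1 := by linear_combination hu
  rw [c1, c2, neg_one_zsmul, one_zsmul]

/-- **The involution of `V = 2^m c c'`** (`c, c' ∈ {±i}`):
`toQ (sigmaSubst V) = [c̄' c̄ 2^m] − [2 c̄ 2^m] − [c̄' 2^{m+1}] + [2^{m+2}]`. [cite: Zhao2008, §4] -/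
theorem toQ_sigmaSubst_V {c cb c' cb' : Fin 5} (h : (c = 1 ∧ cb = 3) ∨ (c = 3 ∧ cb = 1))
    (h' : (c' = 1 ∧ cb' = 3) ∨ (c' = 3 ∧ cb' = 1)) (m : ℕ) :
    toQ (sigmaSubst (List.replicate m (2 : Fin 5) ++ [c, c'])) =
      sym (cb' :: cb :: List.replicate m (2 : Fin 5)) - sym ((2 : Fin 5) :: cb :: List.replicate m 2)
        - sym (cb' :: List.replicate (m + 1) (2 : Fin 5)) + sym (List.replicate (m + 2) (2 : Fin 5)) := by
  have htail : expand sigmaLetter [c, c'] =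
      [((1 : ℤ), [cb, cb']), (-1, [cb, 2]), (-1, [2, cb']), (1, [2, 2])] := by
    rw [expand_cons, expand_cons, sigmaLetter_of_unit h, sigmaLetter_of_unit h', expand_nil]
    simp
  have hlen : (List.replicate m (2 : Fin 5) ++ [c, c']).length = m + 2 := by simp
  rw [sigmaSubst, hlen, expand_sigma_replicate_append, htail]
  simp only [List.map_cons, List.map_nil, List.reverse_append, List.reverse_cons, List.reverse_nil,
    List.nil_append, List.reverse_replicate, ofTerms_cons, ofTerms_nil, add_zero, map_zsmul, map_add,
    toQ_single, mul_one, mul_neg, List.cons_append]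
  have h2 : (2 : Fin 5) :: (2 : Fin 5) :: List.replicate m (2 : Fin 5) = List.replicate (m + 2) 2 := by
    simp [List.replicate_succ]
  have h3 : cb' :: (2 : Fin 5) :: List.replicate m (2 : Fin 5) = cb' :: List.replicate (m + 1) 2 := by
    simp [List.replicate_succ]
  rw [h2, h3, smul_add, smul_add, smul_add, smul_smul, smul_smul, smul_smul, smul_smul, pow_add, neg_one_sq]
  set v : ℤ := (-1) ^ m with hv_def
  have hv : v * v = 1 := neg_one_pow_mul_self _
  have c1 : v * 1 * v = 1 := by linear_combination hv
  have c2 : v * 1 * -v = -1 := by linear_combination (-1 : ℤ) * hv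
  rw [c1, c2, one_zsmul, one_zsmul, neg_one_zsmul, neg_one_zsmul]
  abel

/-! ### The algebraic core of the layer (abstract ℚ-module computation) -/

/-- **Core of the layer `#2 = n − 1`.** In a `ℚ`-module let `x a e` (`a ≤ n − 1`, `e : Bool`) and `z`
satisfy, for `n ≥ 3`: (s) `(a+1) x (a+1) e + (n−1−a) x a e = 0` for `a + 1 ≤ n − 1` (seed lifts),
(i2) `x 1 e + x 0 e = z` (involution of `2^{n−2} ē ē`), (i0) `x 0 e + x (n−1) (!e) = z` (involution of
`e 2^{n−1}`). Then `z = 0` and every `x a e = 0`. [folklore] -/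
theorem layerOne_core {Q : Type*} [AddCommGroup Q] [Module ℚ Q] (n : ℕ) (hn : 3 ≤ n)
    (x : ℕ → Bool → Q) (z : Q)
    (hs : ∀ (a : ℕ) (e : Bool), a + 1 ≤ n - 1 →
      ((a + 1 : ℕ) : ℚ) • x (a + 1) e + ((n - 1 - a : ℕ) : ℚ) • x a e = 0)
    (hi2 : ∀ e : Bool, x 1 e + x 0 e = z)
    (hi0 : ∀ e : Bool, x 0 e + x (n - 1) (!e) = z) :
    z = 0 ∧ ∀ (a : ℕ) (e : Bool), a ≤ n - 1 → x a e = 0 := by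
  -- closed form along the chain (s): `C(n-1, a) • x 0 e = (-1)^a • ... ` written multiplicatively
  have hchain : ∀ (e : Bool) (a : ℕ), a ≤ n - 1 →
      x a e = ((-1 : ℚ) ^ a * ((n - 1).choose a : ℚ)) • x 0 e := by
    intro e a
    induction a with
    | zero => intro _; simp
    | succ a ih =>
      intro ha
      have h1 := hs a e ha
      have ih' := ih (by omega)
      -- (a+1) x_{a+1} = -(n-1-a) x_a
      have hx : ((a + 1 : ℕ) : ℚ) • x (a + 1) e = -(((n - 1 - a : ℕ) : ℚ) • x a e) :=
        eq_neg_of_add_eq_zero_left h1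
      have hne : ((a + 1 : ℕ) : ℚ) ≠ 0 := by exact_mod_cast Nat.succ_ne_zero a
      have hchoose : ((n - 1 - a : ℕ) : ℚ) * ((n - 1).choose a : ℚ) =
          ((a + 1 : ℕ) : ℚ) * ((n - 1).choose (a + 1) : ℚ) := by
        -- choose (n-1) (a+1) * (a+1) = choose (n-1) a * (n-1-a)
        have h' := congrArg (Nat.cast (R := ℚ)) (Nat.choose_succ_right_eq (n - 1) a)
        rw [Nat.cast_mul, Nat.cast_mul] at h'
        rw [mul_comm, ← h', mul_comm]
      apply smul_right_injective Q hne
      simp only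
      rw [hx, ih', smul_smul, ← neg_smul, smul_smul]
      congr 1
      rw [pow_succ]
      have : ((a + 1 : ℕ) : ℚ) * ((-1) ^ a * -1 * ((n - 1).choose (a + 1) : ℚ)) =
          -((-1) ^ a * (((a + 1 : ℕ) : ℚ) * ((n - 1).choose (a + 1) : ℚ))) := by ring
      rw [this, ← hchoose]
      ring
  -- x 1 e = -(n-1) x 0 e and (2 - n) x 0 e = z
  have hx0 : ∀ e : Bool, ((2 : ℚ) - n) • x 0 e = z := by
    intro e
    have h1 := hs 0 e (by omega)
    have h2 := hi2 e
    simp only [zero_add, Nat.cast_one, one_smul, Nat.sub_zero] at h1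
    have hx1 : x 1 e = -(((n - 1 : ℕ) : ℚ) • x 0 e) := eq_neg_of_add_eq_zero_left h1
    rw [hx1] at h2
    rw [← h2, Nat.cast_sub (by omega), Nat.cast_one, sub_smul, neg_add_eq_sub, sub_smul, one_smul]
    abel_nf
    module
  -- x (n-1) (!e) = (-1)^(n-1) x 0 (!e), and x 0 (!e) relates to z like x 0 e
  have hn2 : ((2 : ℚ) - n) ≠ 0 := by
    have : (3 : ℚ) ≤ n := by exact_mod_cast hn
    intro h; linarith
  have hx0eq : ∀ e : Bool, x 0 (!e) = x 0 e := fun e =>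
    smul_right_injective Q hn2 (by simp only; rw [hx0, hx0])
  have hz : z = 0 := by
    have e := true
    have h := hi0 true
    rw [hchain _ (n - 1) le_rfl, Nat.choose_self, Nat.cast_one, mul_one, hx0eq] at h
    -- (1 + (-1)^(n-1)) x 0 true = z = (2 - n) x 0 true
    have hcomb : ((1 : ℚ) + (-1) ^ (n - 1) - (2 - n)) • x 0 true = 0 := by
      rw [sub_smul, add_smul, one_smul, hx0, h, sub_self]
    have hcoef : ((1 : ℚ) + (-1) ^ (n - 1) - (2 - n)) ≠ 0 := by
      have h3 : (3 : ℚ) ≤ n := by exact_mod_cast hn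
      rcases neg_one_pow_eq_or ℚ (n - 1) with h' | h' <;> rw [h'] <;> intro hh <;> linarith
    have hx00 : x 0 true = 0 := (smul_eq_zero.1 hcomb).resolve_left hcoef
    rw [← hx0 true, hx00, smul_zero]
  refine ⟨hz, fun a e ha => ?_⟩
  have hx00 : x 0 e = 0 := by
    have := hx0 e
    rw [hz] at this
    exact (smul_eq_zero.1 this).resolve_left hn2
  rw [hchain e a ha, hx00, smul_zero]


end Summit.KontsevichZagierPeriods.OctahedralSymmetry.OctaSpan.RegularUnit

end
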